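import Summits.Ventures.Crystal3D.Statement
import Summits.Ventures.Crystal3D.LocalLP.LevyHeadline
import Summits.Ventures.Crystal3D.LocalLP.H1Instance
import Summits.Ventures.Crystal3D.LocalLP.SaturationGap
import Summits.Ventures.Crystal3D.StickySpheres.Asymptotics
import HarnessLib

/-!
# Status links: the surface-bound ladder in terms of `Statement.SurfaceBound`

HONEST FRAMING. Part of the venture `Summits/Ventures/Crystal3D` (cell `pub-crystal3d`). This file
only RESTATES already-landed conditional theorems of `LocalLP/` as instances of the venture Prop
`SurfaceBound γ` of `Statement.lean`, so that the paper's ladder rows point at one named Prop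
each. Every theorem here is CONDITIONAL; its hypotheses are exactly the named inputs listed, none
of which is proved in the tree: `Schmidt1948_sphericalIsoperimetric` (Lévy–Schmidt, classical),
`IsoInput 1 (1/4)` (isoperimetric inequality of `ℝ³` for unions of balls, classical),
`LevyCapInput r F` with the cell's certified CELL5 tables (H1, H2), `IsoInput rH2 sH2` (via the
dodecahedral bound), `flyspeck_L12` (Hales 2012, HOL Light). Unconditional rows of the ladder:
`contactsLeSixN_holds` (`C ≤ 6N`) in `Statement.lean`. No crystallization statement is claimed.

| rung | `γ` | hypotheses (trust base) | theorem |
|---|---|---|---|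
| Lévy only | `167/100` | Schmidt1948, IsoInput 1 (1/4) | `surfaceBound_levy_rung` |
| H1 (CELL5, no density theorem) | `23/10` | LevyCapInput 1 FH1, IsoInput 1 (1/4) | `surfaceBound_H1_rung` |
| H2 (CELL5 + DOD + L12) | `79/25` | flyspeck_L12, LevyCapInput rH2 FH2, IsoInput rH2 sH2 | `surfaceBound_H2_rung` |
-/

noncomputable section

namespace Summit.Ventures.Crystal3D

open Literature.Geometry.DiscreteGeometry (Schmidt1948_sphericalIsoperimetric flyspeck_L12)

/-- **Rung `γ = 1.67`** (pure Lévy–Schmidt): `SurfaceBound (167/100)` under the Lévy–Schmidt fact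
and the isoperimetric input at probing radius `1`. -/
theorem surfaceBound_levy_rung (hLevy : Schmidt1948_sphericalIsoperimetric)
    (hI : IsoInput 1 (1 / 4)) : SurfaceBound (167 / 100) :=
  surfaceBound_levy hLevy hI

/-- **Rung `γ = 2.3`** (H1): `SurfaceBound (23/10)` under the cap input with engine-2's table at
probing radius `1` and the isoperimetric input with the exact constant `1/4`. -/
theorem surfaceBound_H1_rung (hL : LevyCapInput 1 FH1) (hI : IsoInput 1 (1 / 4)) :
    SurfaceBound (23 / 10) :=
  H1_surfaceBound hL hI

/-- **Rung `γ = 3.16`** (H2): `SurfaceBound (79/25)` under Flyspeck's `L12`, the cap input with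
engine-2's table at `rH2 = 1783/2000`, and the isoperimetric input `sH2` (dodecahedral cell
bound). -/
theorem surfaceBound_H2_rung (hL12 : flyspeck_L12) (hL : LevyCapInput rH2 FH2)
    (hI : IsoInput rH2 sH2) : SurfaceBound (79 / 25) :=
  H2_surfaceBound_of_L12 hL12 hL hI

/-- The rungs are nested: any of them gives Bezdek–Reid's printed `0.926` as well
(`SurfaceBound` is antitone in `γ`). -/
theorem bezdekReidBound_of_levy_rung (hLevy : Schmidt1948_sphericalIsoperimetric)
    (hI : IsoInput 1 (1 / 4)) : BezdekReidBound :=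
  (surfaceBound_levy_rung hLevy hI).anti (by norm_num)

/-! ## The energetic statement (appended once `StickySpheres/Asymptotics.lean` landed) -/

/-- **`ContactsPerParticleTendstoSix` holds** (PROVED, unconditional): `C(N)/N → 6`, i.e. the
sticky-sphere ground-state energy per particle in `ℝ³` tends to `-6`
(`tendsto_maxContacts_div`: kissing number twelve for the upper bound, fcc cubic chunks and
monotonicity for the lower bound). -/
theorem contactsPerParticleTendstoSix_holds : ContactsPerParticleTendstoSix :=
  tendsto_maxContacts_div

end Summit.Ventures.Crystal3D

end
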